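import Mathlib
import Literature.MathematicalPhysics.MHD.FluxSurfaceAverage
import Literature.MathematicalPhysics.MHD.MercierFluxForm
import HarnessLib

/-!
# Cauchy–Schwarz for the flux-surface average `⟨·⟩` (Jardin 2010 (5.30)) and the sign of the
# Glasser–Greene–Johnson bracket: `⟨σB²/|∇ψ|²⟩² ≤ ⟨σ²B²/|∇ψ|²⟩·⟨B²/|∇ψ|²⟩`, hence `F ≥ 0`,
# `E + H² ≤ D_R` (proved; no named facts)

Sources read on the page: S. Jardin, *Computational Methods in Plasma Physics* (CRC 2010) §5.3
eq. (5.30) [bib `Jardin2010`; typed by gridfusion-model-5 as `GradShafranov.surfaceAverageE`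
(`FluxSurfaceAverage.lean`)]: `⟨a⟩ = (2π/V′)∫₀^{2π} J a dθ = 2π∮ a dℓ/B_p ÷ V′` — a POSITIVE linear
functional (weight `dℓ/B_p ≥ 0`) normalised by `V′`; and §8.5.4 eq. (8.134) (the three averages
`⟨B²/|∇ψ|²⟩`, `⟨σB²/|∇ψ|²⟩`, `⟨σ²B²/|∇ψ|²⟩` of the Mercier criterion, the fields `gB2`, `gσB2`, `gσ2B2` of
gridfusion-lit-3's `Mercier.FluxForm.SurfaceData`, `MercierFluxForm.lean`); L. J. Zheng, *Advanced Tokamak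
Stability Theory* (2015) §2.3 eq. (2.64), §3.2 eq. (3.42) [galaxy:panama:302159539208214 p0036, p0069;
bib `Zheng2015`]: `F = (⟨B²/|∇V|²⟩/Λ²)·{⟨σ²B²/|∇V|²⟩ − ⟨σB²/|∇V|²⟩²/⟨B²/|∇V|²⟩ + P′²⟨1/B²⟩}` and
`D_R = E + F + H²` (`SurfaceData.ggjF`, `SurfaceData.ggjDR`).

WHAT IS PROVED (derived properties of the cited objects, used silently by the sources):
* `surfaceAverageE_sq_le_mul` — GRAM FORM: if `m² ≤ a·b` with `a, b ≥ 0` along the loop then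
  `⟨m⟩² ≤ ⟨a⟩·⟨b⟩` (`0 ≤ T`, the three weighted loop integrands integrable; when `V′ = 0` both sides are
  the junk value `0`);
* `surfaceAverageE_mul_sq_le` — `⟨uv⟩² ≤ ⟨u²⟩·⟨v²⟩`;
* `surfaceAverageE_div_sq_le` — `⟨S/G⟩² ≤ ⟨S²/(P·G)⟩·⟨P/G⟩` for `P, G > 0` along the loop. With
  `S = σB² = J·B`, `P = B²`, `G = |∇ψ|²` this is literally the Cauchy–Schwarz hypothesis
  `hCS : d.gσB2 ^ 2 ≤ d.gσ2B2 * d.gB2` of `SurfaceData.wellTerm_pos_of_mercierCriterion_of_shearless`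
  for every `SurfaceData` whose averages are `surfaceAverageE`s of these integrands — e.g. model-5's
  `Solovev.lcGGJData`, whose three fields have exactly this shape with `S = gΔ*Ψ/R²`, `P = fieldBsq`,
  `G = gradSq` (an INPUT hypothesis until now; a theorem for such data from here, given positivity of
  `B²`, `|∇Ψ|²` and integrability along the loop);
* `SurfaceData.ggjF_nonneg` — `hCS`, `⟨B²/|∇V|²⟩ > 0`, `⟨1/B²⟩ ≥ 0` ⇒ `0 ≤ F` (any shear; `Λ = 0` gives
  the junk value `0`); `SurfaceData.ggjE_add_sq_le_ggjDR` — `E + H² ≤ D_R`;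
  `SurfaceData.ggjE_neg_of_ggjDR_neg` — `D_R < 0 ⇒ E < 0`; `SurfaceData.ggjE_add_ggjH_lt_of_ggjStable` —
  `−D_I > 0 ⇒ E + H < 1/4`.

THREE COLUMNS: CERTIFIED = the inequalities below (exact real analysis / algebra, kernel-checked);
VALIDATED = nothing here; MODELLED = the objects are ideal/resistive-MHD MODEL quantities (flux-surface
averages of an axisymmetric equilibrium; the GGJ singular layer of Zheng §3.2) — no device claim, no
stability claim beyond the printed definitions.  Proof route: pointwise `a s² − 2 m s + b ≥ 0`, integrate
against the weight `|γ′|/B_p ≥ 0`, discriminant (`discrim_le_zero`); no Hölder machinery.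
Typer/prover: gridfusion-lit-3 (g4), 2026-08-27.
-/

noncomputable section

namespace Literature.MathematicalPhysics.MHD.GradShafranov

open _root_.Real _root_.MeasureTheory _root_.intervalIntegral _root_.Set

/-! ## §1 Cauchy–Schwarz for the positive functional `a ↦ ∫₀ᵀ w·a` and for `⟨·⟩` (5.30) -/

/-- Pointwise step: `a, b ≥ 0`, `m² ≤ ab` ⇒ the quadratic `a s² − 2 m s + b` is non-negative. [folklore] -/
private theorem quad_nonneg_of_sq_le {a b m : ℝ} (ha : 0 ≤ a) (hb : 0 ≤ b) (hm : m ^ 2 ≤ a * b)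
    (s : ℝ) : 0 ≤ a * s ^ 2 - 2 * m * s + b := by
  rcases ha.eq_or_lt with h0 | hpos
  · have hm0 : m = 0 := by
      have h1 : m ^ 2 ≤ 0 := by rw [← h0, zero_mul] at hm; exact hm
      exact pow_eq_zero_iff (n := 2) (by norm_num) |>.mp (le_antisymm h1 (sq_nonneg m))
    rw [← h0, hm0]; linarith
  · have key : a * 0 ≤ a * (a * s ^ 2 - 2 * m * s + b) := by
      rw [mul_zero]; nlinarith [sq_nonneg (a * s - m)]
    exact le_of_mul_le_mul_left key hpos

/-- Cauchy–Schwarz in Gram form for the positive functional `a ↦ ∫₀ᵀ w·a` (`w ≥ 0` on `[0,T]`): if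
`m² ≤ ab`, `a, b ≥ 0` on `[0,T]` then `(∫ w m)² ≤ (∫ w a)(∫ w b)` — the discriminant of
`s ↦ ∫ w (a s² − 2 m s + b) ≥ 0`. [folklore] -/
private theorem sq_integral_le_of_pointwise {T : ℝ} (hT : 0 ≤ T) {w a b m : ℝ → ℝ}
    (hw : ∀ t ∈ Icc 0 T, 0 ≤ w t) (ha : ∀ t ∈ Icc 0 T, 0 ≤ a t) (hb : ∀ t ∈ Icc 0 T, 0 ≤ b t)
    (hm : ∀ t ∈ Icc 0 T, m t ^ 2 ≤ a t * b t)
    (him : IntervalIntegrable (fun t => w t * m t) volume 0 T)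
    (hia : IntervalIntegrable (fun t => w t * a t) volume 0 T)
    (hib : IntervalIntegrable (fun t => w t * b t) volume 0 T) :
    (∫ t in (0:ℝ)..T, w t * m t) ^ 2
      ≤ (∫ t in (0:ℝ)..T, w t * a t) * ∫ t in (0:ℝ)..T, w t * b t := by
  have hq : ∀ s : ℝ, 0 ≤ (∫ t in (0:ℝ)..T, w t * a t) * (s * s)
      + (-(2 * ∫ t in (0:ℝ)..T, w t * m t)) * s + ∫ t in (0:ℝ)..T, w t * b t := by
    intro s
    have hnn : 0 ≤ ∫ t in (0:ℝ)..T, w t * (a t * s ^ 2 - 2 * m t * s + b t) :=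
      intervalIntegral.integral_nonneg hT fun t ht =>
        mul_nonneg (hw t ht) (quad_nonneg_of_sq_le (ha t ht) (hb t ht) (hm t ht) s)
    have e : ∀ t, w t * (a t * s ^ 2 - 2 * m t * s + b t)
        = s ^ 2 * (w t * a t) - 2 * s * (w t * m t) + w t * b t := fun t => by ring
    simp_rw [e] at hnn
    rw [intervalIntegral.integral_add ((hia.const_mul _).sub (him.const_mul _)) hib,
      intervalIntegral.integral_sub (hia.const_mul _) (him.const_mul _),
      intervalIntegral.integral_const_mul, intervalIntegral.integral_const_mul] at hnn
    linarith [hnn]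
  have hd := discrim_le_zero hq
  rw [discrim] at hd
  nlinarith [hd]

/-- Scaling step: `I_m² ≤ I_a I_b ⇒ (c I_m/V)² ≤ (c I_a/V)(c I_b/V)`. [folklore] -/
private theorem scaled_sq_le_mul (c V : ℝ) {Im Ia Ib : ℝ} (h : Im ^ 2 ≤ Ia * Ib) :
    (c * Im / V) ^ 2 ≤ c * Ia / V * (c * Ib / V) := by
  have h2 := mul_le_mul_of_nonneg_left h (sq_nonneg (c / V))
  calc (c * Im / V) ^ 2 = (c / V) ^ 2 * Im ^ 2 := by ring
    _ ≤ (c / V) ^ 2 * (Ia * Ib) := h2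
    _ = c * Ia / V * (c * Ib / V) := by ring

/-- **Cauchy–Schwarz for the surface average (5.30), Gram form.** `⟨·⟩ = 2π∮(·)dℓ/B_p ÷ V′` is a positive
linear functional (weight `|γ′|/B_p ≥ 0`) divided by the constant `V′`, so pointwise `m² ≤ a·b` with
`a, b ≥ 0` along the loop `γ : [0,T] → (R,Z)` (`0 ≤ T`) gives `⟨m⟩² ≤ ⟨a⟩·⟨b⟩` (the three weighted loop
integrands integrable; for `V′ = 0` both sides are the junk value `0`). A derived property of the printed
average. [cite: Jardin2010, §5.3 eq. (5.30)] -/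
theorem surfaceAverageE_sq_le_mul {ψ : ℝ → ℝ → ℝ} {γ : ℝ → ℝ × ℝ} {T : ℝ} (hT : 0 ≤ T)
    {a b m : ℝ → ℝ → ℝ}
    (ha : ∀ t ∈ uIcc 0 T, 0 ≤ a (γ t).1 (γ t).2) (hb : ∀ t ∈ uIcc 0 T, 0 ≤ b (γ t).1 (γ t).2)
    (hm : ∀ t ∈ uIcc 0 T, m (γ t).1 (γ t).2 ^ 2 ≤ a (γ t).1 (γ t).2 * b (γ t).1 (γ t).2)
    (him : IntervalIntegrable
      (fun t => m (γ t).1 (γ t).2 / fieldBpol ψ (γ t).1 (γ t).2 * speed γ t) volume 0 T)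
    (hia : IntervalIntegrable
      (fun t => a (γ t).1 (γ t).2 / fieldBpol ψ (γ t).1 (γ t).2 * speed γ t) volume 0 T)
    (hib : IntervalIntegrable
      (fun t => b (γ t).1 (γ t).2 / fieldBpol ψ (γ t).1 (γ t).2 * speed γ t) volume 0 T) :
    surfaceAverageE ψ γ T m ^ 2 ≤ surfaceAverageE ψ γ T a * surfaceAverageE ψ γ T b := by
  unfold surfaceAverageE loopIntegralE
  -- the weight `w = |γ′|/B_p ≥ 0` (two square roots)
  have hw : ∀ t ∈ Icc 0 T, 0 ≤ speed γ t / fieldBpol ψ (γ t).1 (γ t).2 := fun t _ => by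
    unfold speed fieldBpol
    exact div_nonneg (Real.sqrt_nonneg _) (Real.sqrt_nonneg _)
  have e : ∀ (x : ℝ) (t : ℝ), x / fieldBpol ψ (γ t).1 (γ t).2 * speed γ t
      = speed γ t / fieldBpol ψ (γ t).1 (γ t).2 * x := fun x t => by ring
  simp_rw [e] at him hia hib ⊢
  rw [uIcc_of_le hT] at ha hb hm
  exact scaled_sq_le_mul (2 * π) (volumeDerivE ψ γ T)
    (sq_integral_le_of_pointwise hT hw ha hb hm him hia hib)

/-- **Cauchy–Schwarz for the surface average (5.30):** `⟨uv⟩² ≤ ⟨u²⟩·⟨v²⟩` along any loop (`0 ≤ T`,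
the three weighted loop integrands integrable). [cite: Jardin2010, §5.3 eq. (5.30)] -/
theorem surfaceAverageE_mul_sq_le {ψ : ℝ → ℝ → ℝ} {γ : ℝ → ℝ × ℝ} {T : ℝ} (hT : 0 ≤ T)
    {u v : ℝ → ℝ → ℝ}
    (huv : IntervalIntegrable
      (fun t => u (γ t).1 (γ t).2 * v (γ t).1 (γ t).2 / fieldBpol ψ (γ t).1 (γ t).2 * speed γ t)
      volume 0 T)
    (huu : IntervalIntegrable
      (fun t => u (γ t).1 (γ t).2 ^ 2 / fieldBpol ψ (γ t).1 (γ t).2 * speed γ t) volume 0 T)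
    (hvv : IntervalIntegrable
      (fun t => v (γ t).1 (γ t).2 ^ 2 / fieldBpol ψ (γ t).1 (γ t).2 * speed γ t) volume 0 T) :
    surfaceAverageE ψ γ T (fun R Z => u R Z * v R Z) ^ 2
      ≤ surfaceAverageE ψ γ T (fun R Z => u R Z ^ 2) * surfaceAverageE ψ γ T (fun R Z => v R Z ^ 2) :=
  surfaceAverageE_sq_le_mul hT (a := fun R Z => u R Z ^ 2) (b := fun R Z => v R Z ^ 2)
    (m := fun R Z => u R Z * v R Z) (fun _ _ => sq_nonneg _) (fun _ _ => sq_nonneg _)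
    (fun _ _ => (mul_pow _ _ 2).le) huv huu hvv

/-- **The Cauchy–Schwarz sign of the parallel-current bracket of the Mercier criterion (8.134).** For loop
functions `S` (any sign) and `P, G > 0` along the loop, `⟨S/G⟩² ≤ ⟨S²/(P·G)⟩·⟨P/G⟩`.  With
`S = σB² = J·B`, `P = B²`, `G = |∇ψ|²` the three averages are the printed `⟨σB²/|∇ψ|²⟩`, `⟨σ²B²/|∇ψ|²⟩`,
`⟨B²/|∇ψ|²⟩` of (8.134), i.e. this is the hypothesis `hCS : d.gσB2 ^ 2 ≤ d.gσ2B2 * d.gB2` of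
`SurfaceData.wellTerm_pos_of_mercierCriterion_of_shearless` (and of `SurfaceData.ggjF_nonneg` below) for
every `SurfaceData` whose fields are these `surfaceAverageE`s — so the bracket
`⟨σB²/|∇ψ|²⟩² − ⟨σ²B²/|∇ψ|²⟩⟨B²/|∇ψ|²⟩` of (8.134) is `≤ 0` (destabilising or null) on every surface.
(`0 ≤ T`; the three weighted loop integrands integrable.) [cite: Jardin2010, §8.5.4 eq. (8.134)] -/
theorem surfaceAverageE_div_sq_le {ψ : ℝ → ℝ → ℝ} {γ : ℝ → ℝ × ℝ} {T : ℝ} (hT : 0 ≤ T)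
    {S P G : ℝ → ℝ → ℝ}
    (hP : ∀ t ∈ uIcc 0 T, 0 < P (γ t).1 (γ t).2) (hG : ∀ t ∈ uIcc 0 T, 0 < G (γ t).1 (γ t).2)
    (hiS : IntervalIntegrable
      (fun t => S (γ t).1 (γ t).2 / G (γ t).1 (γ t).2 / fieldBpol ψ (γ t).1 (γ t).2 * speed γ t)
      volume 0 T)
    (hiS2 : IntervalIntegrable
      (fun t => S (γ t).1 (γ t).2 ^ 2 / (P (γ t).1 (γ t).2 * G (γ t).1 (γ t).2)
        / fieldBpol ψ (γ t).1 (γ t).2 * speed γ t) volume 0 T)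
    (hiP : IntervalIntegrable
      (fun t => P (γ t).1 (γ t).2 / G (γ t).1 (γ t).2 / fieldBpol ψ (γ t).1 (γ t).2 * speed γ t)
      volume 0 T) :
    surfaceAverageE ψ γ T (fun R Z => S R Z / G R Z) ^ 2
      ≤ surfaceAverageE ψ γ T (fun R Z => S R Z ^ 2 / (P R Z * G R Z))
        * surfaceAverageE ψ γ T (fun R Z => P R Z / G R Z) :=
  surfaceAverageE_sq_le_mul hT (a := fun R Z => S R Z ^ 2 / (P R Z * G R Z))
    (b := fun R Z => P R Z / G R Z) (m := fun R Z => S R Z / G R Z)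
    (fun t ht => div_nonneg (sq_nonneg _) (mul_pos (hP t ht) (hG t ht)).le)
    (fun t ht => div_nonneg (hP t ht).le (hG t ht).le)
    (fun t ht => by
      have hP0 : P (γ t).1 (γ t).2 ≠ 0 := (hP t ht).ne'
      have hG0 : G (γ t).1 (γ t).2 ≠ 0 := (hG t ht).ne'
      apply le_of_eq
      field_simp)
    hiS hiS2 hiP

end Literature.MathematicalPhysics.MHD.GradShafranov

/-! ## §2 Consequences for the GGJ pieces of a `SurfaceData` record: `F ≥ 0`, `E + H² ≤ D_R` -/

namespace Literature.MathematicalPhysics.MHD.Mercier.FluxForm.SurfaceData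

variable (d : SurfaceData)

/-- `F ≥ 0`: granted the Cauchy–Schwarz sign of the parallel-current bracket
(`⟨σB²/|∇V|²⟩² ≤ ⟨σ²B²/|∇V|²⟩⟨B²/|∇V|²⟩`, a theorem for averages of the form (5.30) —
`GradShafranov.surfaceAverageE_div_sq_le`), `⟨B²/|∇V|²⟩ > 0` and `⟨1/B²⟩ ≥ 0`, the printed
`F = (⟨B²/|∇V|²⟩/Λ²)·{⟨σ²B²/|∇V|²⟩ − ⟨σB²/|∇V|²⟩²/⟨B²/|∇V|²⟩ + P′²⟨1/B²⟩}` is non-negative (any shear `Λ`;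
at `Λ = 0` it is the junk value `0`). Derived sign. [cite: Zheng2015, §2.3 eq. (2.64)] -/
theorem ggjF_nonneg (hCS : d.gσB2 ^ 2 ≤ d.gσ2B2 * d.gB2) (hg : 0 < d.gB2) (hinv : 0 ≤ d.invB2) :
    0 ≤ d.ggjF := by
  unfold ggjF
  have h1 : 0 ≤ d.gσ2B2 - d.gσB2 ^ 2 / d.gB2 := by
    rw [sub_nonneg, div_le_iff₀ hg]
    linarith
  have h2 : 0 ≤ d.p' ^ 2 * d.invB2 := mul_nonneg (sq_nonneg _) hinv
  exact mul_nonneg (div_nonneg hg.le (sq_nonneg _)) (by linarith)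

/-- Hence `E + H² ≤ D_R = E + F + H²` (same hypotheses). Derived. [cite: Zheng2015, §3.2 eq. (3.42)] -/
theorem ggjE_add_sq_le_ggjDR (sB2 B2 : ℝ) (hCS : d.gσB2 ^ 2 ≤ d.gσ2B2 * d.gB2) (hg : 0 < d.gB2)
    (hinv : 0 ≤ d.invB2) : d.ggjE sB2 B2 + d.ggjH sB2 B2 ^ 2 ≤ d.ggjDR sB2 B2 := by
  unfold ggjDR
  linarith [d.ggjF_nonneg hCS hg hinv]

/-- Hence `D_R < 0` (no resistive interchange in the sense of (3.42)) forces `E < 0` (same hypotheses).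
Derived. [cite: Zheng2015, §3.2 eq. (3.42)] -/
theorem ggjE_neg_of_ggjDR_neg (sB2 B2 : ℝ) (hCS : d.gσB2 ^ 2 ≤ d.gσ2B2 * d.gB2) (hg : 0 < d.gB2)
    (hinv : 0 ≤ d.invB2) (h : d.ggjDR sB2 B2 < 0) : d.ggjE sB2 B2 < 0 := by
  nlinarith [d.ggjE_add_sq_le_ggjDR sB2 B2 hCS hg hinv, sq_nonneg (d.ggjH sB2 B2)]

/-- And Mercier stability in GGJ form, `−D_I > 0` with `D_I = E + F + H − 1/4`, forces `E + H < 1/4`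
(same hypotheses). Derived. [cite: Zheng2015, §2.3 eq. (2.66)] -/
theorem ggjE_add_ggjH_lt_of_ggjStable (sB2 B2 : ℝ) (hCS : d.gσB2 ^ 2 ≤ d.gσ2B2 * d.gB2)
    (hg : 0 < d.gB2) (hinv : 0 ≤ d.invB2) (h : d.GGJStable sB2 B2) :
    d.ggjE sB2 B2 + d.ggjH sB2 B2 < 1 / 4 := by
  unfold GGJStable ggjDI at h
  linarith [d.ggjF_nonneg hCS hg hinv]

end Literature.MathematicalPhysics.MHD.Mercier.FluxForm.SurfaceData

end
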